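import Summits.BirchSwinnertonDyer.BirchSwinnertonDyer.Theorems.PrintCf2RamifiedOffTYZLevelTwoHalfGenerator
import Literature.NumberTheory.EllipticCurves.MordellWeilTheoremProofs
import HarnessLib

/-!
# Route `PrintCf2`, crux stmt-BirchSwinnertonDyer-20509 `RamifiedOffTYZOfFacts` — C⁺ AT `n` ⟺ THE GENUS POINT `P(n)` AND THE
# HALF `Q₁` OF THE MORDELL–WEIL GENERATOR HAVE THE SAME `2`-ADIC DEPTH in `A(ℍ′_n)/tors`
# (cell `bsd-print-cf2`, LEAD of 20509 g3, line `offtyz-v7`, lineage cycle 4, sequel of `…LevelTwoHalfGenerator`; fact-free,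
# Theses-free, no `def`)

HONEST FRAMING (cell `bsd-print-cf2`; route `PrintCf2`; crux 20509 = `𝔅_ram → WAllCornerFTwoRamifiedOffTYZProved`, DECIDING,
OPEN AS A CLASS): bookkeeping on Tian–Yuan–Zhang's Theorem 3.5 main clause taken as a HYPOTHESIS on the displayed data
(`D.thm35Main`, `D.scriptLSpec` on `D : GenusPointData n`), the tree's `2`-descent algebra (W2 kernel) and the tree's PROVED
Mordell–Weil theorem over number fields (`exists_isMordellWeilBasis_holds`) — nothing asserted, no named fact introduced.
C⁺ = `stub_offTYZ_levelTwoScriptLExact` (`2 ∥ 𝓛(n)` on the jump-one rank-one class; OPEN, NO PRINT) stays open.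

`…LevelTwoHalfGenerator` proved `2·P(n) ≡ ±𝓛(n)·Q₁ (mod tors)` for any half `Q₁` of the twisted Mordell–Weil generator and
«C⁺ at `n` ⟺ `P(n) ≡ odd·Q₁`», whence C⁺ ⟹ equal `2`-adic depth of `P(n)` and `Q₁` at every level.  THIS FILE proves the
CONVERSE, so that the level-two statement of the line becomes a pure comparison of two depths:

* §1 `levelTwo_of_twoPowDivisible_iff` (abstract, any additive commutative group): `2·P − (u·L)·Q ∈ tors` (`u = ±1`), equal depth
  of `P`, `Q` at every level, and FINITE depth of `P` ⟹ `2 ∣ L ∧ 4 ∤ L` (if `L` were odd, resp. `4 ∣ L`, divisibility would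
  propagate from `P` to `Q`, resp. from `Q` to `P`, one level up forever — Bezout `a·(uL) + b·2^{k+1} = 1` in the odd case).
* §2 `exists_not_twoPowDivisible_of_not_isOfFinAddOrder`: a NON-torsion point of an elliptic curve over a number field has finite
  `2`-adic depth modulo torsion (coordinates in a Mordell–Weil basis of `E(K)/tors`: `2^k ∣ c ≠ 0` bounds `k`);
  `exists_not_twoPowDivisible_genusPoint`: on the rank-one class `P(n)` is non-torsion (`𝓛(n) ≠ 0`, `Q₁` non-torsion), so it
  has finite depth in `A(ℍ′_n)`; **`levelTwo_iff_twoPowDivisible_iff_half`: C⁺ at `n` ⟺ ∀ k, (`P(n) ∈ 2^k A(ℍ′_n) + tors` ⟺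
  `Q₁ ∈ 2^k A(ℍ′_n) + tors`)** — granted GZK, Thm 3.5's displayed main clause and integrality, for every generator `R` of
  `E_n(ℚ)` modulo torsion and every half `Q₁` (`φ_H(Q₁) = ι Θ_E(R)`).

* §3 (append) THE DEPTH-SHIFT LAW at every level: `twoPowDivisible_shift_iff_of_odd` (abstract), and on `E_n` —
  `twoPowDivisible_genusPoint_iff_half_of_even` (`𝓛(n) = 2^v·m`, `m` odd, `v ≥ 1`: `P(n) ∈ 2^{k+v−1}A + tors ⟺ Q₁ ∈ 2^kA + tors`),
  `twoPowDivisible_half_iff_genusPoint_of_odd` (`𝓛(n)` odd: `Q₁ ∈ 2^{k+1}A + tors ⟺ P(n) ∈ 2^kA + tors`): together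
  **`v₂(𝓛(n)) = 1 + depth P(n) − depth Q₁`** for every square-free `n` with `rank ≤ 1` and `𝓛(n) ≠ 0` — the `2`-adic valuation of
  TYZ's integer is one plus the depth gap (jump-one: gap `0`; `Ш[2^∞] ≅ (ℤ/4)²`: gap `1`; TYZ's odd families: gap `−1`).

What this buys the line (LEAD census, crux 20509): the research kernel of C⁺ is now ONE comparison «`depth_{A(ℍ′_n)/tors}(P(n)) =
depth_{A(ℍ′_n)/tors}(Q₁)`» between the genus point and the half of the rational generator — `ρ(n)`, `α_n`, `A(K_n)⁻` and the odd
multiplier are gone.  The right side is a Kummer/CFT datum of `(E_n(ℚ), ℍ′_n)` (decidable per `n`); the left side is the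
beyond-print object (no display of TYZ §3 sees the depth of a genus point beyond parity).  Beyond-print theorem: NO (bookkeeping
+ Mordell–Weil).  BSD is not proved by any of this; no class is closed by this file.

References: [cite: TianYuanZhang2017, Thm. 3.5 (arXiv:1411.4728 chunk p0011 L94–L100), §3.1 (p0011 L27–L36)]; [cite: SilvermanAEC2009,
VIII.6 (Mordell–Weil), Prop. X.4.9]; [cite: Darmon2004, Thm. 3.22] (GZK); tree: `…LevelTwoHalfGenerator`, `…LevelTwoRhoValve` (g3),
`…LevelTwoModTwo` (g2), `…LevelTwoGenusPoint` (g0), `Literature/…/MordellWeilTheoremProofs.lean`.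
-/

noncomputable section

open scoped Classical

open WeierstrassCurve WeierstrassCurve.Affine Literature.NumberTheory.EllipticCurves
  Literature.NumberTheory.EllipticCurves.Rank1Residual Summit.BirchSwinnertonDyer.Rank1Residual
  Literature.NumberTheory.EllipticCurves.TianYuanZhang2017
  Literature.NumberTheory.EllipticCurves.TianYuanZhang2017.W2
  Summit.BirchSwinnertonDyer.PrintCf2.LevelTwoHalfGenerator

set_option autoImplicit false

namespace Summit.BirchSwinnertonDyer.PrintCf2.LevelTwoDepth

/-! ## §1 Abstract: equal `2`-adic depth at every level + finite depth ⟹ the exact digit -/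

section AbstractDepth

variable {G : Type*} [AddCommGroup G]

/-- **Equal depth ⟹ exact digit (abstract).** If `2·P − (u·L)·Q` has finite order with `u = ±1`, `P` and `Q` have the same
`2`-adic depth modulo torsion at every level, and `P` has FINITE depth, then `2 ∣ L ∧ 4 ∤ L`.  (`L` odd or `4 ∣ L` would
propagate divisibility from one of `P, Q` to the other one level up, forever.) [folklore] -/
theorem levelTwo_of_twoPowDivisible_iff {P Q : G} {L u : ℤ} (hu : u = 1 ∨ u = -1)
    (hrel : IsOfFinAddOrder ((2 : ℤ) • P - (u * L) • Q))
    (hdepth : ∀ k : ℕ, (∃ y : G, IsOfFinAddOrder (P - ((2 : ℤ) ^ k) • y)) ↔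
      ∃ y : G, IsOfFinAddOrder (Q - ((2 : ℤ) ^ k) • y))
    (hfin : ∃ k : ℕ, ¬ ∃ y : G, IsOfFinAddOrder (P - ((2 : ℤ) ^ k) • y)) :
    (2 : ℤ) ∣ L ∧ ¬ (4 : ℤ) ∣ L := by
  obtain ⟨k₀, hk₀⟩ := hfin
  have hQall : ¬ ∀ k : ℕ, ∃ y : G, IsOfFinAddOrder (Q - ((2 : ℤ) ^ k) • y) :=
    fun h => hk₀ ((hdepth k₀).mpr (h k₀))
  have hQ0 : ∃ y : G, IsOfFinAddOrder (Q - ((2 : ℤ) ^ 0) • y) := ⟨Q, by simp⟩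
  rcases Int.even_or_odd L with ⟨L₁, hL₁⟩ | hLodd
  · -- `L = L₁ + L₁`: `P ≡ (u L₁) Q`
    have hP : IsOfFinAddOrder (P - (u * L₁) • Q) := by
      have e : (2 : ℤ) • P - (u * L) • Q = (2 : ℤ) • (P - (u * L₁) • Q) := by rw [hL₁]; module
      rw [e] at hrel
      exact LevelTwo.isOfFinAddOrder_of_zsmul two_ne_zero hrel
    rcases Int.even_or_odd L₁ with ⟨L₂, hL₂⟩ | hL₁odd
    · -- `4 ∣ L`: then `Q ∈ 2^k + tors` for every `k`
      exfalso
      apply hQall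
      intro k
      induction k with
      | zero => exact hQ0
      | succ k ih =>
        obtain ⟨y, hy⟩ := ih
        refine (hdepth (k + 1)).mp ⟨(u * L₂) • y, ?_⟩
        have e : P - ((2 : ℤ) ^ (k + 1)) • ((u * L₂) • y) =
            (P - (u * L₁) • Q) + (2 * u * L₂) • (Q - ((2 : ℤ) ^ k) • y) := by
          rw [hL₂, pow_succ]; module
        rw [e]
        exact hP.add hy.zsmul
    · refine ⟨⟨L₁, by rw [hL₁]; ring⟩, ?_⟩
      rintro ⟨q, hq⟩
      obtain ⟨j, hj⟩ := hL₁odd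
      omega
  · -- `L` odd: then `Q ∈ 2^k + tors` for every `k` (Bezout)
    exfalso
    apply hQall
    intro k
    induction k with
    | zero => exact hQ0
    | succ k ih =>
      obtain ⟨y', hy'⟩ := (hdepth k).mpr ih
      have huL : Odd (u * L) := by
        rcases hu with rfl | rfl
        · simpa using hLodd
        · simpa using hLodd.neg
      obtain ⟨a, b, hab⟩ := isCoprime_two_pow_of_odd huL (k + 1)
      refine ⟨a • y' + b • Q, ?_⟩
      have e : Q - ((2 : ℤ) ^ (k + 1)) • (a • y' + b • Q) =
          (1 - (a * (u * L) + b * 2 ^ (k + 1))) • Q + (-a) • ((2 : ℤ) • P - (u * L) • Q) +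
            (a * 2) • (P - ((2 : ℤ) ^ k) • y') := by
        rw [pow_succ]; module
      rw [e, hab, sub_self, zero_smul, zero_add]
      exact hrel.zsmul.add hy'.zsmul

end AbstractDepth

/-! ## §2 Finite depth (Mordell–Weil) and the headline: C⁺ at `n` ⟺ `depth P(n) = depth Q₁` -/

section Depth

variable {n : ℕ}

/-- **A non-torsion point of an elliptic curve over a number field has FINITE `2`-adic depth modulo torsion**: some
`2^k·y` misses `x + tors` (Mordell–Weil: `E(K)/tors` is free of finite rank; read the coordinates of `x` in a basis).
[cite: SilvermanAEC2009, VIII.6] -/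
theorem exists_not_twoPowDivisible_of_not_isOfFinAddOrder {K : Type*} [Field K] [NumberField K] [dK : DecidableEq K]
    (W : WeierstrassCurve K) [W.IsElliptic] {x : W.toAffine.Point} (hx : ¬ IsOfFinAddOrder x) :
    ∃ k : ℕ, ¬ ∃ y : W.toAffine.Point, IsOfFinAddOrder (x - ((2 : ℤ) ^ k) • y) := by
  have e : dK = Classical.decEq K := Subsingleton.elim _ _
  subst e
  obtain ⟨P, hli, hspan⟩ := W.exists_isMordellWeilBasis_holds
  set b : Module.Basis (Fin W.mordellWeilRank) ℤ (mordellWeilModTorsion W) := Module.Basis.mk hli (by rw [hspan])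
    with hb
  set xb : mordellWeilModTorsion W := QuotientAddGroup.mk x with hxb
  have hxb0 : xb ≠ 0 := by
    intro h0
    rw [hxb, QuotientAddGroup.eq_zero_iff] at h0
    exact hx h0
  -- a non-zero coordinate
  obtain ⟨i, hi⟩ : ∃ i, b.repr xb i ≠ 0 := by
    by_contra h
    push Not at h
    exact hxb0 (b.ext_elem fun i => by rw [h i, map_zero, Finsupp.zero_apply])
  -- `k` with `2^k > |coordinate|`
  refine ⟨(b.repr xb i).natAbs, ?_⟩
  rintro ⟨y, hy⟩
  have hq : xb = ((2 : ℤ) ^ (b.repr xb i).natAbs) • (QuotientAddGroup.mk y : mordellWeilModTorsion W) := by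
    rw [← sub_eq_zero, hxb, ← QuotientAddGroup.mk_zsmul, ← QuotientAddGroup.mk_sub, QuotientAddGroup.eq_zero_iff,
      AddCommGroup.mem_torsion]
    exact hy
  have hcoord : b.repr xb i = (2 : ℤ) ^ (b.repr xb i).natAbs * b.repr (QuotientAddGroup.mk y) i := by
    conv_lhs => rw [hq]
    rw [map_zsmul, Finsupp.smul_apply, smul_eq_mul]
  have hd : b.repr (QuotientAddGroup.mk y : mordellWeilModTorsion W) i ≠ 0 := fun h => hi (by rw [hcoord, h, mul_zero])
  have hnat : (b.repr xb i).natAbs =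
      2 ^ (b.repr xb i).natAbs * (b.repr (QuotientAddGroup.mk y : mordellWeilModTorsion W) i).natAbs := by
    conv_lhs => rw [hcoord]
    rw [Int.natAbs_mul, Int.natAbs_pow]
    rfl
  have hpos : 0 < (b.repr (QuotientAddGroup.mk y : mordellWeilModTorsion W) i).natAbs := Int.natAbs_pos.mpr hd
  have hle : 2 ^ (b.repr xb i).natAbs ≤
      2 ^ (b.repr xb i).natAbs * (b.repr (QuotientAddGroup.mk y : mordellWeilModTorsion W) i).natAbs :=
    Nat.le_mul_of_pos_right _ hpos
  have hlt : (b.repr xb i).natAbs < 2 ^ (b.repr xb i).natAbs := Nat.lt_two_pow_self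
  omega

/-- **The genus point `P(n)` has FINITE `2`-adic depth modulo torsion on the rank-one class** (it is non-torsion: `2·P(n) ≡
±𝓛(n)·Q₁` with `𝓛(n) ≠ 0` and `Q₁` non-torsion; then Mordell–Weil over `ℍ′_n`). [cite: TianYuanZhang2017, Thm. 3.5 (chunk p0011 L94–L100)] [cite: SilvermanAEC2009, VIII.6] [cite: Darmon2004, Thm. 3.22] -/
theorem exists_not_twoPowDivisible_genusPoint
    (hGZK : rank_eq_analyticRank_of_analyticRank_le_one) (hsq : Squarefree n)
    (h8 : n % 8 = 5 ∨ n % 8 = 6 ∨ n % 8 = 7) (hr : (congruentNumberCurve n).analyticRank = 1)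
    (D : GenusPointData n) (h35 : D.thm35Main) (hLs : D.scriptLSpec) :
    ∃ k : ℕ, ¬ ∃ y : APoint D.H, IsOfFinAddOrder (D.P n - ((2 : ℤ) ^ k) • y) := by
  haveI := isElliptic_congruentNumberCurve hsq.ne_zero
  have hn : n ∈ n.divisors := Nat.mem_divisors_self n hsq.ne_zero
  have hn1 : 1 < n := by rcases h8 with h | h | h <;> omega
  have hLD : IsScriptL n (D.scriptL n) := hLs n hn hn1
  have hL0 : D.scriptL n ≠ 0 := (P2.bsdp_two_congruentNumberCurve_iff_of_isScriptL hGZK hsq hr hLD).2.2.1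
  have hrank : (congruentNumberCurve n).mordellWeilRank = 1 := (hGZK _ hr.le).1.trans hr
  obtain ⟨R, hR⟩ := stub_S0 (n := n) hrank.le
  obtain ⟨Q₁, hQ₁⟩ := twist_halving hsq hn D R
  obtain ⟨x, hx⟩ := LevelTwo.exists_not_isOfFinAddOrder_of_one_le_rank (congruentNumberCurve n) hrank.ge
  have hRnt : ¬ IsOfFinAddOrder R := LevelTwo.not_isOfFinAddOrder_of_generates hx (hR x)
  have hQnt : ¬ IsOfFinAddOrder Q₁ := not_isOfFinAddOrder_half hsq D hRnt hQ₁
  obtain ⟨u, hu, hrel⟩ := two_smul_genusPoint_sub_smul_half_isOfFinAddOrder hsq hrank.le D h35 hL0 hR hQ₁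
  have hPnt : ¬ IsOfFinAddOrder (D.P n) := by
    intro hP
    apply hQnt
    have h1 : IsOfFinAddOrder ((u * D.scriptL n) • Q₁) := by
      have e : (u * D.scriptL n) • Q₁ = (2 : ℤ) • D.P n + -((2 : ℤ) • D.P n - (u * D.scriptL n) • Q₁) := by abel
      rw [e]
      exact hP.zsmul.add hrel.neg
    have hu0 : u * D.scriptL n ≠ 0 := mul_ne_zero (by rcases hu with rfl | rfl <;> norm_num) hL0
    exact LevelTwo.isOfFinAddOrder_of_zsmul hu0 h1
  exact exists_not_twoPowDivisible_of_not_isOfFinAddOrder (curveA.baseChange D.H) hPnt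

/-- **EQUAL DEPTH ⟹ C⁺** (the converse of `twoPowDivisible_iff_of_levelTwo`). Square-free `n ≡ 5, 6, 7 (mod 8)` with
`ord_{s=1} L(E_n, s) = 1`; GZK; data `D` with Thm 3.5's displayed main clause and integrality; `R` a generator of `E_n(ℚ)`
modulo torsion; `Q₁` a half of its twist.  If `P(n)` and `Q₁` have the same `2`-adic depth modulo torsion at every level,
then the conclusion of C⁺ holds at `n`. [cite: TianYuanZhang2017, Thm. 3.5 (chunk p0011 L94–L100)] [cite: Darmon2004, Thm. 3.22] -/
theorem levelTwo_of_twoPowDivisible_iff_half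
    (hGZK : rank_eq_analyticRank_of_analyticRank_le_one) (hsq : Squarefree n)
    (h8 : n % 8 = 5 ∨ n % 8 = 6 ∨ n % 8 = 7) (hr : (congruentNumberCurve n).analyticRank = 1)
    (D : GenusPointData n) (h35 : D.thm35Main) (hLs : D.scriptLSpec)
    {R : (congruentNumberCurve n).toAffine.Point} (hR : ∀ x, ∃ k : ℤ, IsOfFinAddOrder (x - k • R))
    {Q₁ : APoint D.H} (hQ₁ : φH D Q₁ = Point.map (W' := curveA.twoIsogenyCodomain)
      (D.embK n (Nat.mem_divisors_self n hsq.ne_zero)) (ΘE hsq.ne_zero R))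
    (hdepth : ∀ k : ℕ, (∃ y : APoint D.H, IsOfFinAddOrder (D.P n - ((2 : ℤ) ^ k) • y)) ↔
      ∃ y : APoint D.H, IsOfFinAddOrder (Q₁ - ((2 : ℤ) ^ k) • y)) :
    ∀ L : ℤ, IsScriptL n L → (2 : ℤ) ∣ L ∧ ¬ (4 : ℤ) ∣ L := by
  haveI := isElliptic_congruentNumberCurve hsq.ne_zero
  have hn : n ∈ n.divisors := Nat.mem_divisors_self n hsq.ne_zero
  have hn1 : 1 < n := by rcases h8 with h | h | h <;> omega
  have hLD : IsScriptL n (D.scriptL n) := hLs n hn hn1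
  have hL0 : D.scriptL n ≠ 0 := (P2.bsdp_two_congruentNumberCurve_iff_of_isScriptL hGZK hsq hr hLD).2.2.1
  have hrank : (congruentNumberCurve n).mordellWeilRank = 1 := (hGZK _ hr.le).1.trans hr
  obtain ⟨u, hu, hrel⟩ := two_smul_genusPoint_sub_smul_half_isOfFinAddOrder hsq hrank.le D h35 hL0 hR hQ₁
  have hfin := exists_not_twoPowDivisible_genusPoint hGZK hsq h8 hr D h35 hLs
  have key := levelTwo_of_twoPowDivisible_iff hu hrel hdepth hfin
  intro L hL
  exact LevelTwo.two_dvd_not_four_dvd_of_eq_or_eq_neg (LevelTwo.eq_or_eq_neg_of_isScriptL hL hLD) key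

/-- **C⁺ AT `n` ⟺ THE GENUS POINT AND THE HALF OF THE MORDELL–WEIL GENERATOR HAVE THE SAME `2`-ADIC DEPTH** in
`A(ℍ′_n)` modulo torsion (same data): `(∀ L, 𝓛(n)² = L² → 2 ∥ L) ⟺ ∀ k, (P(n) ∈ 2^k A(ℍ′_n) + tors ⟺ Q₁ ∈ 2^k A(ℍ′_n) + tors)`.
The level-two statement of the line with `ρ(n)`, `α_n` AND the odd multiplier eliminated: a pure comparison of two depths.
[cite: TianYuanZhang2017, Thm. 3.5 (chunk p0011 L94–L100)] [cite: SilvermanAEC2009, VIII.6] [cite: Darmon2004, Thm. 3.22] -/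
theorem levelTwo_iff_twoPowDivisible_iff_half
    (hGZK : rank_eq_analyticRank_of_analyticRank_le_one) (hsq : Squarefree n)
    (h8 : n % 8 = 5 ∨ n % 8 = 6 ∨ n % 8 = 7) (hr : (congruentNumberCurve n).analyticRank = 1)
    (D : GenusPointData n) (h35 : D.thm35Main) (hLs : D.scriptLSpec)
    {R : (congruentNumberCurve n).toAffine.Point} (hR : ∀ x, ∃ k : ℤ, IsOfFinAddOrder (x - k • R))
    {Q₁ : APoint D.H} (hQ₁ : φH D Q₁ = Point.map (W' := curveA.twoIsogenyCodomain)
      (D.embK n (Nat.mem_divisors_self n hsq.ne_zero)) (ΘE hsq.ne_zero R)) :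
    (∀ L : ℤ, IsScriptL n L → (2 : ℤ) ∣ L ∧ ¬ (4 : ℤ) ∣ L) ↔
      ∀ k : ℕ, ((∃ y : APoint D.H, IsOfFinAddOrder (D.P n - ((2 : ℤ) ^ k) • y)) ↔
        ∃ y : APoint D.H, IsOfFinAddOrder (Q₁ - ((2 : ℤ) ^ k) • y)) :=
  ⟨fun hC k => twoPowDivisible_iff_of_levelTwo hGZK hsq h8 hr D h35 hLs hR hQ₁ hC k,
    levelTwo_of_twoPowDivisible_iff_half hGZK hsq h8 hr D h35 hLs hR hQ₁⟩

end Depth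

/-! ## §3 (append, LEAD g3) THE DEPTH-SHIFT LAW: `v₂(𝓛(n)) = 1 + depth P(n) − depth Q₁` at every level -/

section AbstractShift

variable {G : Type*} [AddCommGroup G]

/-- **Depth shift by an odd multiple of `2^j` (abstract).** If `P − (c·2^j)·Q` has finite order with `c` ODD, then for every
`k`: `P ∈ 2^{k+j} G + G_tor ⟺ Q ∈ 2^k G + G_tor` (cancel `2^j` inside the torsion relation, then Bezout for `c`). [folklore] -/
theorem twoPowDivisible_shift_iff_of_odd {P Q : G} {c : ℤ} (hc : Odd c) {j : ℕ}
    (h : IsOfFinAddOrder (P - (c * 2 ^ j) • Q)) (k : ℕ) :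
    (∃ y : G, IsOfFinAddOrder (P - ((2 : ℤ) ^ (k + j)) • y)) ↔ ∃ y : G, IsOfFinAddOrder (Q - ((2 : ℤ) ^ k) • y) := by
  -- `c • Q` and `Q` have the same depth
  have hcQ : (∃ y : G, IsOfFinAddOrder (c • Q - ((2 : ℤ) ^ k) • y)) ↔ ∃ y : G, IsOfFinAddOrder (Q - ((2 : ℤ) ^ k) • y) :=
    twoPowDivisible_iff_of_odd_zsmul hc (by rw [sub_self]; exact IsOfFinAddOrder.zero) k
  rw [← hcQ]
  constructor
  · rintro ⟨y, hy⟩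
    refine ⟨y, ?_⟩
    -- `2^j • (cQ − 2^k y) = (P − 2^{k+j} y) − (P − c 2^j Q)` is torsion
    have h2 : IsOfFinAddOrder (((2 : ℤ) ^ j) • (c • Q - ((2 : ℤ) ^ k) • y)) := by
      have e : ((2 : ℤ) ^ j) • (c • Q - ((2 : ℤ) ^ k) • y) =
          (P - ((2 : ℤ) ^ (k + j)) • y) + -(P - (c * 2 ^ j) • Q) := by
        rw [pow_add]; module
      rw [e]
      exact hy.add h.neg
    exact LevelTwo.isOfFinAddOrder_of_zsmul (pow_ne_zero _ two_ne_zero) h2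
  · rintro ⟨y, hy⟩
    refine ⟨y, ?_⟩
    have e : P - ((2 : ℤ) ^ (k + j)) • y = (P - (c * 2 ^ j) • Q) + ((2 : ℤ) ^ j) • (c • Q - ((2 : ℤ) ^ k) • y) := by
      rw [pow_add]; module
    rw [e]
    exact h.add hy.zsmul

end AbstractShift

section Shift

variable {n : ℕ}

/-- **THE DEPTH-SHIFT LAW, `𝓛(n)` EVEN.** Square-free `n` with `rank E_n(ℚ) ≤ 1`; data `D` with Thm 3.5's displayed main clause;
the data's `𝓛(n) = 2^v·m` with `m` odd and `v ≥ 1`; `R` a generator of `E_n(ℚ)` modulo torsion, `Q₁` any half of its twist.  Then for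
every `k`: **`P(n) ∈ 2^{k+v−1} A(ℍ′_n) + tors ⟺ Q₁ ∈ 2^k A(ℍ′_n) + tors`** — i.e. `depth P(n) = depth Q₁ + v₂(𝓛(n)) − 1`: the
`2`-adic valuation of Tian–Yuan–Zhang's `𝓛(n)` IS one plus the depth gap between the genus point and the half of the Mordell–Weil
generator.  (`v = 1`: the jump-one prediction `depth P(n) = depth Q₁`; `v = 2`: the `Ш(E_n)[2^∞] ≅ (ℤ/4)²` prediction
`depth P(n) = depth Q₁ + 1`, read through the door `P2.bsdp_two_congruentNumberCurve_iff_of_isScriptL` with `#Ш[2^∞] = 16`.)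
[cite: TianYuanZhang2017, Thm. 3.5 (chunk p0011 L94–L100)] [cite: SilvermanAEC2009, Prop. X.4.9] -/
theorem twoPowDivisible_genusPoint_iff_half_of_even (hsq : Squarefree n) [(congruentNumberCurve n).IsElliptic]
    (hr1 : (congruentNumberCurve n).mordellWeilRank ≤ 1) (D : GenusPointData n) (h35 : D.thm35Main)
    {v : ℕ} {m : ℤ} (hm : Odd m) (hv : 1 ≤ v) (hLvm : D.scriptL n = 2 ^ v * m)
    {R : (congruentNumberCurve n).toAffine.Point} (hR : ∀ x, ∃ k : ℤ, IsOfFinAddOrder (x - k • R))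
    {Q₁ : APoint D.H} (hQ₁ : φH D Q₁ = Point.map (W' := curveA.twoIsogenyCodomain)
      (D.embK n (Nat.mem_divisors_self n hsq.ne_zero)) (ΘE hsq.ne_zero R)) (k : ℕ) :
    (∃ y : APoint D.H, IsOfFinAddOrder (D.P n - ((2 : ℤ) ^ (k + (v - 1))) • y)) ↔
      ∃ y : APoint D.H, IsOfFinAddOrder (Q₁ - ((2 : ℤ) ^ k) • y) := by
  have hL0 : D.scriptL n ≠ 0 := by
    rw [hLvm]; obtain ⟨j, rfl⟩ := hm
    exact mul_ne_zero (pow_ne_zero _ two_ne_zero) (by omega)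
  obtain ⟨u, hu, hrel⟩ := two_smul_genusPoint_sub_smul_half_isOfFinAddOrder hsq hr1 D h35 hL0 hR hQ₁
  obtain ⟨w, hw⟩ : ∃ w, v = w + 1 := ⟨v - 1, by omega⟩
  have hvw : v - 1 = w := by omega
  -- `P ≡ (u m)·2^{v−1} Q₁`
  have hP : IsOfFinAddOrder (D.P n - ((u * m) * 2 ^ w) • Q₁) := by
    have e : (2 : ℤ) • D.P n - (u * D.scriptL n) • Q₁ = (2 : ℤ) • (D.P n - ((u * m) * 2 ^ w) • Q₁) := by
      rw [hLvm, hw, pow_succ]; module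
    rw [e] at hrel
    exact LevelTwo.isOfFinAddOrder_of_zsmul two_ne_zero hrel
  have hum : Odd (u * m) := by
    rcases hu with rfl | rfl
    · simpa using hm
    · simpa using hm.neg
  rw [hvw]
  exact twoPowDivisible_shift_iff_of_odd hum hP k

/-- **THE DEPTH-SHIFT LAW, `𝓛(n)` ODD** (same data, the data's `𝓛(n)` odd): for every `k`,
**`Q₁ ∈ 2^{k+1} A(ℍ′_n) + tors ⟺ P(n) ∈ 2^k A(ℍ′_n) + tors`** — `depth Q₁ = depth P(n) + 1` (the Tian–Yuan–Zhang families: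
`v₂(𝓛(n)) = 0 = 1 + depth P(n) − depth Q₁`). [cite: TianYuanZhang2017, Thm. 3.5 (chunk p0011 L94–L100), Thm. 1.2] -/
theorem twoPowDivisible_half_iff_genusPoint_of_odd (hsq : Squarefree n) [(congruentNumberCurve n).IsElliptic]
    (hr1 : (congruentNumberCurve n).mordellWeilRank ≤ 1) (D : GenusPointData n) (h35 : D.thm35Main)
    (hodd : Odd (D.scriptL n))
    {R : (congruentNumberCurve n).toAffine.Point} (hR : ∀ x, ∃ k : ℤ, IsOfFinAddOrder (x - k • R))
    {Q₁ : APoint D.H} (hQ₁ : φH D Q₁ = Point.map (W' := curveA.twoIsogenyCodomain)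
      (D.embK n (Nat.mem_divisors_self n hsq.ne_zero)) (ΘE hsq.ne_zero R)) (k : ℕ) :
    (∃ y : APoint D.H, IsOfFinAddOrder (Q₁ - ((2 : ℤ) ^ (k + 1)) • y)) ↔
      ∃ y : APoint D.H, IsOfFinAddOrder (D.P n - ((2 : ℤ) ^ k) • y) := by
  have hL0 : D.scriptL n ≠ 0 := by obtain ⟨j, hj⟩ := hodd; omega
  obtain ⟨u, hu, hrel⟩ := two_smul_genusPoint_sub_smul_half_isOfFinAddOrder hsq hr1 D h35 hL0 hR hQ₁
  have huL : Odd (u * D.scriptL n) := by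
    rcases hu with rfl | rfl
    · simpa using hodd
    · simpa using hodd.neg
  -- `(uL)·Q₁ ≡ 2^1·P`: the shift lemma with the roles of `P`, `Q` exchanged (`c = 1`, `j = 1`) after Bezout on `uL`
  have hcQ : (∃ y : APoint D.H, IsOfFinAddOrder ((u * D.scriptL n) • Q₁ - ((2 : ℤ) ^ (k + 1)) • y)) ↔
      ∃ y : APoint D.H, IsOfFinAddOrder (Q₁ - ((2 : ℤ) ^ (k + 1)) • y) :=
    twoPowDivisible_iff_of_odd_zsmul huL (by rw [sub_self]; exact IsOfFinAddOrder.zero) (k + 1)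
  rw [← hcQ]
  have hrel' : IsOfFinAddOrder ((u * D.scriptL n) • Q₁ - (1 * 2 ^ 1) • D.P n) := by
    have e : (u * D.scriptL n) • Q₁ - (1 * 2 ^ 1) • D.P n = -((2 : ℤ) • D.P n - (u * D.scriptL n) • Q₁) := by module
    rw [e]
    exact hrel.neg
  exact twoPowDivisible_shift_iff_of_odd odd_one hrel' k

end Shift

end Summit.BirchSwinnertonDyer.PrintCf2.LevelTwoDepth

end
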